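import Literature.NumberTheory.GaloisRepresentations.IdeleLocalInvariantsRestrictionArch
import Literature.NumberTheory.AdelicBaseChange.IntegralClosureLocalization
import HarnessLib

/-!
# `inv^{E/K}(Res_{Gal(E/K)} c) = [K:F] · inv^{E/F}(c)` on `H²(Gal(E/F), J_E)` (Tate, C–F VII §11.2 (7): "as the sum of
# the local degrees `Σ_{w/v} n_{w/v} = n = [L:K]`")

Topic `NumberTheory/GaloisRepresentations`; namespaces `Literature.NumberTheory.GaloisRepresentations.SemiLocal` /
`….ArchHerbrand` (the two local-degree identities) and `….IdeleCohomology` (the global statement).  Sequel to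
`IdeleLocalInvariantsRestriction.lean` (finite places: `localInv E v' (Res c) = [K_{v'} : F_v] • localInv E v c`) and
`IdeleLocalInvariantsRestrictionArch.lean` (infinite places: `localInvInf E v' (Res c) = (n_v / n_{v'}) • localInvInf E v c`).
Definition with body (`infRelDegree`, the relative local degree `[K_{v'} : F_v] ∈ {1, 2}` at an infinite place) and
theorems; NO named fact, no `sorry`, no instance, no notation; number fields in `Type`.

Mathematics.  Tate, C–F VII §11.2 [held copy `book:editornd-algebraic-number-theory` p0233]: from (15)
`inv_w(res α) = n_{w/v} inv_v(α)` one gets the commutative square (7), `inv₃ ∘ res = n · inv₂`, "as the sum of the local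
degrees `Σ_{w/v} n_{w/v} = n = [L:K]`."  At the finite places the sum of the local degrees over the places of `K` above
`v` is the fundamental identity `Σ e f = [K:F]` (C–F II §10; Mathlib `Ideal.sum_ramification_inertia_eq_finrank` via the
tree's `Ideal.sum_ramification_inertia_extensions` and `[K_{v'} : F_v] = e f`, `finrank_place_eq_ramificationIdx_mul_inertiaDeg`);
at the infinite places it is `#{unramified v' ∣ v} + 2 · #{ramified v' ∣ v} = [K:F]` (Mathlib
`unramifedPlacesOver_ncard_add_eq_finrank`), once the ratio of decomposition-group orders `n_v / n_{v'}` is identified with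
`[K_{v'} : F_v] = 1` or `2` according as `v'` is unramified over `F` or not (Mathlib `InfinitePlace.card_stabilizer`).

## What is formalised (`F K E : Type` number fields, `IsScalarTower F K E`, `E/F` Galois where marked)

* §1 `SemiLocal.sum_finrank_place_eq_finrank`: `∑_{v' ∣ v} [K_{v'} : F_v] = [K:F]` (finite `v`).
* §2 `ArchHerbrand.infRelDegree F v' ∈ {1,2}`, `natCard_stabilizer_eq_infRelDegree_mul` (`n_v = [K_{v'}:F_v] · n_{v'}`),
  `sum_infRelDegree_eq_finrank` (`∑_{v' ∣ v} [K_{v'} : F_v] = [K:F]`, `v` infinite).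
* §3 **`IdeleCohomology.inv_ideleRes`**: `inv (ideleRes F K E 2 c) = [K:F] • inv c`, and `invHom_comp_ideleRes`.

## References
* J. W. S. Cassels, A. Fröhlich (eds.), *Algebraic Number Theory* (1967), Ch. VII (J. Tate) §9.7 (15), §11.2 (7);
  Ch. II §10 (local degrees). [CasselsFrohlichANT1967]
* J. Neukirch, *Algebraic Number Theory* (1999), Ch. I (8.2), Ch. II (8.5) (fundamental identity). [NeukirchANT1999]
-/

noncomputable section

open NumberField NumberField.InfinitePlace IsDedekindDomain CategoryTheory groupCohomology
open Literature.NumberTheory.Automorphic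
open scoped Classical

namespace Literature.NumberTheory.GaloisRepresentations

/-! ## §1. Finite places: `∑_{v' ∣ v} [K_{v'} : F_v] = [K:F]` -/

namespace SemiLocal

open Literature.NumberTheory.NumberFields

variable {F K : Type} [Field F] [Field K] [NumberField F] [NumberField K] [Algebra F K]

/-- **The fundamental identity for local degrees at a finite place**: `∑_{v' ∣ v} [K_{v'} : F_v] = [K : F]`
(`[K_{v'} : F_v] = e(v'|v) f(v'|v)` and `Σ e f = [K:F]`). [cite: CasselsFrohlichANT1967, Ch. II §10]
[cite: NeukirchANT1999, Ch. II Prop. (8.5)] -/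
theorem sum_finrank_place_eq_finrank (v : HeightOneSpectrum (𝓞 F)) :
    ∑ v' : Place F K v, Module.finrank (v.adicCompletion F) ((v' : HeightOneSpectrum (𝓞 K)).adicCompletion K) =
      Module.finrank F K := by
  rw [← Ideal.sum_ramification_inertia_extensions (𝓞 F) F K (𝓞 K) v]
  refine Fintype.sum_equiv (Equiv.refl _) _ _ fun v' => ?_
  exact finrank_place_eq_ramificationIdx_mul_inertiaDeg v'

end SemiLocal

/-! ## §2. Infinite places: the relative local degree and `∑_{v' ∣ v} [K_{v'} : F_v] = [K:F]` -/

namespace ArchHerbrand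

section Degree

variable {F K : Type} [Field F] [Field K] [Algebra F K]

variable (F) in
/-- **The relative local degree `[K_{v'} : F_v] ∈ {1, 2}` at an infinite place `v'` of `K`**: `1` if `v'` is unramified over
`F` (the restriction has the same multiplicity), `2` if `v'` is complex over a real place (Mathlib
`InfinitePlace.IsUnramified`). [cite: CasselsFrohlichANT1967, Ch. II §10] -/
def infRelDegree (v' : InfinitePlace K) : ℕ := if v'.IsUnramified F then 1 else 2

/-- Unfolding `infRelDegree`. [cite: CasselsFrohlichANT1967, Ch. II §10] -/
theorem infRelDegree_eq (v' : InfinitePlace K) : infRelDegree F v' = if v'.IsUnramified F then 1 else 2 := rfl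

/-- `infRelDegree F v'` is positive. [cite: CasselsFrohlichANT1967, Ch. II §10] -/
theorem infRelDegree_pos (v' : InfinitePlace K) : 0 < infRelDegree F v' := by
  unfold infRelDegree; split_ifs <;> decide

/-- The multiplicity of an infinite place is `1` or `2`. [folklore] -/
private theorem mult_eq_one_or_two {L : Type} [Field L] (w : InfinitePlace L) : mult w = 1 ∨ mult w = 2 := by
  unfold mult; split_ifs
  · exact Or.inl rfl
  · exact Or.inr rfl

/-- `w ∣ v` (Mathlib's `LiesOver` of absolute values) iff `IsOver` (equality of restrictions). [folklore] -/
private theorem liesOver_iff_isOver {v : InfinitePlace F} {w : InfinitePlace K} : w.1.LiesOver v.1 ↔ IsOver K v w :=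
  ⟨fun _ => Subtype.ext (AbsoluteValue.LiesOver.comp_eq w.1 v.1), fun h => ⟨congrArg Subtype.val h⟩⟩

end Degree

section Tower

variable {F K E : Type} [Field F] [Field K] [Field E] [NumberField F] [NumberField K] [NumberField E]
  [Algebra F K] [Algebra K E] [Algebra F E] [IsScalarTower F K E]

omit [NumberField F] [NumberField K] [NumberField E] in
/-- **`n_v = [K_{v'} : F_v] · n_{v'}`**: for `E/F` Galois and an infinite place `w₀` of `E` above `v'` of `K`, the orders of the
decomposition groups `Stab_{Gal(E/F)}(w₀)` and `Stab_{Gal(E/K)}(w₀)` differ by the factor `infRelDegree F v'` (Mathlib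
`InfinitePlace.card_stabilizer`: `#Stab = 1` or `2` according as `w₀` is unramified or not; the multiplicities
`mult v ≤ mult v' ≤ mult w₀` lie in `{1, 2}`). [cite: CasselsFrohlichANT1967, Ch. VII §1.1] -/
theorem natCard_stabilizer_eq_infRelDegree_mul [IsGalois F E] {v' : InfinitePlace K} {w₀ : InfinitePlace E}
    (hw₀ : IsOver E v' w₀) :
    Nat.card (MulAction.stabilizer (E ≃ₐ[F] E) w₀) =
      infRelDegree F v' * Nat.card (MulAction.stabilizer (E ≃ₐ[K] E) w₀) := by
  haveI : IsGalois K E := IsGalois.tower_top_of_isGalois F K E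
  rw [InfinitePlace.card_stabilizer, InfinitePlace.card_stabilizer, infRelDegree_eq]
  unfold InfinitePlace.IsUnramified
  have hKw : w₀.comap (algebraMap K E) = v' := hw₀
  have hFw : w₀.comap (algebraMap F E) = v'.comap (algebraMap F K) := by
    rw [← hKw, InfinitePlace.comap_comap_tower F K E]
  rw [hFw, hKw]
  have hab : mult (v'.comap (algebraMap F K)) ≤ mult v' := mult_comap_le _ _
  have hbc : mult v' ≤ mult w₀ := by rw [← hKw]; exact mult_comap_le _ _
  rcases mult_eq_one_or_two (v'.comap (algebraMap F K)) with ha | ha <;>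
    rcases mult_eq_one_or_two v' with hb | hb <;>
      rcases mult_eq_one_or_two w₀ with hc | hc <;>
        simp [ha, hb, hc] at hab hbc ⊢

omit [NumberField E] [Algebra K E] [Algebra F E] [IsScalarTower F K E] in
/-- **The fundamental identity for local degrees at an infinite place**: `∑_{v' ∣ v} [K_{v'} : F_v] = [K : F]`
(`#unramified + 2 · #ramified = [K:F]`, Mathlib `unramifedPlacesOver_ncard_add_eq_finrank`).
[cite: CasselsFrohlichANT1967, Ch. II §10] -/
theorem sum_infRelDegree_eq_finrank (v : InfinitePlace F) :
    ∑ v' ∈ (Finset.univ : Finset (InfinitePlace K)) with IsOver K v v', infRelDegree F v' = Module.finrank F K := by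
  rw [← unramifedPlacesOver_ncard_add_eq_finrank (L := K) v]
  have hU : unramifiedPlacesOver K v =
      ↑((Finset.univ : Finset (InfinitePlace K)).filter fun v' => IsOver K v v' ∧ v'.IsUnramified F) := by
    ext v'
    simp only [unramifiedPlacesOver, Set.mem_setOf_eq, Finset.coe_filter, Finset.mem_univ, true_and, liesOver_iff_isOver]
  have hR : ramifiedPlacesOver K v =
      ↑((Finset.univ : Finset (InfinitePlace K)).filter fun v' => IsOver K v v' ∧ ¬ v'.IsUnramified F) := by
    ext v'
    simp only [ramifiedPlacesOver, Set.mem_setOf_eq, Finset.coe_filter, Finset.mem_univ, true_and, liesOver_iff_isOver,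
      InfinitePlace.IsRamified]
  rw [hU, hR, Set.ncard_coe_finset, Set.ncard_coe_finset]
  simp only [infRelDegree_eq]
  rw [Finset.sum_ite, Finset.sum_const, Finset.sum_const, smul_eq_mul, smul_eq_mul, mul_one, Finset.filter_filter,
    Finset.filter_filter, mul_comm]

end Tower

end ArchHerbrand

/-! ## §3. `inv^{E/K}(Res c) = [K:F] · inv^{E/F}(c)` -/

namespace IdeleCohomology

open Literature.Algebra.Homology SemiLocal ArchHerbrand

section Tower

variable {F K E : Type} [Field F] [Field K] [Field E] [NumberField F] [NumberField K] [NumberField E]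
  [Algebra F K] [Algebra K E] [Algebra F E] [IsScalarTower F K E]

/-- **Tate VII §11.2 (7): `inv^{E/K}(Res_{Gal(E/K)} c) = [K:F] · inv^{E/F}(c)`** for every class `c ∈ H²(Gal(E/F), J_E)` of
a finite Galois `E/F` and every intermediate field `K` (Galois or not over `F`) — the sum over the places of `K` of Tate's
(15), using `∑_{v' ∣ v} [K_{v'} : F_v] = [K:F]` at every finite and every infinite place of `F`.
[cite: CasselsFrohlichANT1967, Ch. VII §11.2 (7)] -/
theorem inv_ideleRes [IsGalois F E] (c : groupCohomology (IdeleClassGroup.ideleRep F E) 2) :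
    haveI : IsGalois K E := IsGalois.tower_top_of_isGalois F K E
    inv (F := K) E (ideleRes F K E 2 c) = Module.finrank F K • inv E c := by
  haveI : IsGalois K E := IsGalois.tower_top_of_isGalois F K E
  obtain ⟨T, hT⟩ := exists_finset_forall_localInv_eq_zero c
  -- the places of `K` above `T`
  let emb : (Σ v : HeightOneSpectrum (𝓞 F), Place F K v) ↪ HeightOneSpectrum (𝓞 K) :=
    (Equiv.sigmaFiberEquiv fun w : HeightOneSpectrum (𝓞 K) => w.under (𝓞 F)).toEmbedding
  let T' : Finset (HeightOneSpectrum (𝓞 K)) :=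
    (T.sigma fun v => (Finset.univ : Finset (Place F K v))).map emb
  -- (the argument of `localInv` is kept syntactically a `Place.val`: comparing `localInv E x` with `localInv E y` for
  -- merely definitionally equal `x`, `y` makes the unifier unfold `localInv`)
  have hemb : ∀ (v : HeightOneSpectrum (𝓞 F)) (w : Place F K v), emb ⟨v, w⟩ = (w : HeightOneSpectrum (𝓞 K)) :=
    fun _ _ => rfl
  have hT' : ∀ v' : HeightOneSpectrum (𝓞 K), v' ∉ T' → localInv E v' (ideleRes F K E 2 c) = 0 := by
    intro v' hv'
    obtain ⟨v, w, rfl⟩ : ∃ (v : HeightOneSpectrum (𝓞 F)) (w : Place F K v), (w : HeightOneSpectrum (𝓞 K)) = v' :=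
      ⟨v'.under (𝓞 F), ⟨v', rfl⟩, rfl⟩
    have hv : v ∉ T := by
      intro h
      apply hv'
      rw [Finset.mem_map]
      exact ⟨⟨v, w⟩, Finset.mem_sigma.mpr ⟨h, Finset.mem_univ _⟩, hemb v w⟩
    rw [localInv_ideleRes w c, hT v hv, smul_zero]
  rw [inv_eq_sum _ T' hT', inv_eq_sum _ T hT, smul_add, Finset.smul_sum, Finset.smul_sum]
  congr 1
  · -- finite places
    rw [Finset.sum_map, Finset.sum_sigma]
    refine Finset.sum_congr rfl fun v _ => ?_
    simp_rw [hemb]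
    calc ∑ w : Place F K v, localInv E (w : HeightOneSpectrum (𝓞 K)) (ideleRes F K E 2 c)
        = ∑ w : Place F K v, Module.finrank (v.adicCompletion F) ((w : HeightOneSpectrum (𝓞 K)).adicCompletion K) •
            localInv E v c := Finset.sum_congr rfl fun w _ => localInv_ideleRes w c
      _ = Module.finrank F K • localInv E v c := by
          rw [← Finset.sum_smul, sum_finrank_place_eq_finrank]
  · -- infinite places
    rw [← Finset.sum_fiberwise (Finset.univ : Finset (InfinitePlace K)) (fun v' => v'.comap (algebraMap F K))
      (fun v' => localInvInf E v' (ideleRes F K E 2 c))]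
    refine Finset.sum_congr rfl fun v _ => ?_
    calc ∑ v' ∈ (Finset.univ : Finset (InfinitePlace K)) with v'.comap (algebraMap F K) = v,
          localInvInf E v' (ideleRes F K E 2 c)
        = ∑ v' ∈ (Finset.univ : Finset (InfinitePlace K)) with IsOver K v v', infRelDegree F v' • localInvInf E v c := by
          refine Finset.sum_congr rfl fun v' hv' => ?_
          have hv : IsOver K v v' := (Finset.mem_filter.mp hv').2
          rw [localInvInf_ideleRes hv (isOver_placeOver (E := E) v') c,
            natCard_stabilizer_eq_infRelDegree_mul (F := F) (isOver_placeOver (E := E) v'),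
            Nat.mul_div_cancel _ Nat.card_pos]
      _ = Module.finrank F K • localInvInf E v c := by
          rw [← Finset.sum_smul, sum_infRelDegree_eq_finrank]

/-- **`invHom ∘ Res = [K:F] · invHom`** as additive homomorphisms `H²(Gal(E/F), J_E) →+ ℚ/ℤ` (Tate's square (7)).
[cite: CasselsFrohlichANT1967, Ch. VII §11.2 (7)] -/
theorem invHom_comp_ideleRes [IsGalois F E] :
    haveI : IsGalois K E := IsGalois.tower_top_of_isGalois F K E
    (invHom (F := K) (E := E)).comp (ideleRes F K E 2).hom.toAddMonoidHom = Module.finrank F K • invHom (F := F) (E := E) := by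
  haveI : IsGalois K E := IsGalois.tower_top_of_isGalois F K E
  ext c
  exact inv_ideleRes c

end Tower

end IdeleCohomology

end Literature.NumberTheory.GaloisRepresentations

end
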